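import Summits.CriticalPhenomena.PercolationContinuityZ3.Theorems.FK.InfiniteVolumeDLRInvariantLimit
import HarnessLib

/-!
# FK-continuity transplant, FO-10 (infinite-volume structure): no percolation without long-range order for EVERY
# translation-invariant DLR random-cluster measure and every translation-invariant local limit, every `q > 0`
# (the Aizenman–Duminil-Copin–Sidoravicius density bound `θ² ≤ |B|⁻² ∑_{x,y∈B} P[x ↔ y]`, FKG-free)

Registered R107 (cell INBOX l.7291, 2026-08-25); registry row FO-10b-g412d; label DRE-E (coordinator fk-4 g222).
Cell `fk-continuity` (bschramm), FO-10b lineage; support file for the FK-continuity transplant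
(`--supports stmt-CriticalPhenomena-4575`); builds on p205010 (kernel theorem, internal audit signed; external
expert review pending). CONDITIONAL cell (FH AND TP_FK open at the same `p` for `q > 1`; K1); the transplant is a
typed reduction, not a proof of FK continuity — this file is UNCONDITIONAL infinite-volume structure for general `d`;
no defs, no named facts, no sorries, standard axioms; NOT a binder discharge, NOT `_r4`; `_r3` « 2 / 0 ☑ »
unchanged, n_open = 2.

## What this file proves

Aizenman–Duminil-Copin–Sidoravicius (CMP 334 (2015), proof of Thm. 3.1, eqs. (3.4)–(3.5), Remark 3.2: "uniqueness of
the infinite cluster used as a substitute for the … FKG inequality") bound `P[0 ↔ ∞]² ≤ |B|⁻² ∑_{x,y∈B} P[x ↔ y]` for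
translation-invariant measures with at most one infinite cluster (tree: `sq_measureReal_percolatesAt_le`,
`Literature.Probability.Percolation.UniqueClusterDensityBound`). With Burton–Keane WITHOUT ergodicity
(`InfiniteVolumeDLRInvariantUniqueness.lean`) the uniqueness input holds for every lattice-carried translation-invariant
member of `R_{p,q}` and every translation-invariant local limit of (4.38)-measures (`InfiniteVolumeDLRInvariantLimit.lean`),
for EVERY `q > 0` — in particular for `q < 1`, where no FKG inequality is available:

* **`IsDLRRandomCluster.sq_measureReal_percolatesAt_le_of_shift_invariant`** — `P(0 ↔ ∞)² ≤ |B|⁻² ∑_{x,y∈B} P(x ↔ y)`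
  for every lattice-carried translation-invariant `P ∈ R_{p,q}`, `0 < p ≤ 1`, `q > 0`, every nonempty finite `B`;
* **`IsDLRRandomCluster.measure_percolatesAt_eq_zero_of_shift_invariant_of_forall_exists`** — hence no percolation as
  soon as `inf_B |B|⁻² ∑_{x,y∈B} τ(x,y) = 0` for some majorant `τ ≥ P(· ↔ ·)` ("`M_LRO = 0 ⇒ θ = 0`", FKG-free);
* `sq_measureReal_percolatesAt_le_of_localLimit_of_shift_invariant` — the same density bound for every lattice-carried
  translation-invariant local limit of finite measures with the one-edge conditional probabilities (4.38);
* `FKGibbs.ae_numInfiniteClusters_le_one_of_shift_invariant`, `FKGibbs.sq_measureReal_percolatesAt_le_of_shift_invariant` —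
  the same for every translation-invariant member of the sandwich class `FKGibbs` (`q > 0`), dropping the tail-triviality of
  the tree's `FKGibbs.ae_numInfiniteClusters_le_one_of_isTailTrivial`.

## References

* M. Aizenman, H. Duminil-Copin, V. Sidoravicius, Comm. Math. Phys. 334 (2015) 719–742, Thm. 3.1, (3.4)–(3.5),
  Remark 3.2. [AizenmanDuminilCopinSidoraviciusCMP2015]
* G. Grimmett, *The Random-Cluster Model*, Springer 2006, Thm. (4.33)(c), Prop. (4.37)(a). [Grimmett2006]
-/

noncomputable section

open MeasureTheory Filter Set

open scoped Topology ENNReal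

namespace Summit.CriticalPhenomena.PercolationContinuityZ3.Theorems.FK

open Literature.Probability.Percolation Literature.Probability.LatticeModels

variable {d : ℕ} {p q : ℝ} {P : Measure (BondConfig (Site d))}

/-- **ADS15 density bound for every translation-invariant DLR random-cluster measure, every `q > 0`**: for a
lattice-carried `P ∈ R_{p,q}` invariant under the translations of `ℤ^d` (`0 < p ≤ 1`) and every nonempty finite `B`,
`P(0 ↔ ∞)² ≤ |B|⁻² ∑_{x,y∈B} P(x ↔ y)` — uniqueness of the infinite cluster (Burton–Keane without ergodicity) replaces
FKG. [cite: AizenmanDuminilCopinSidoraviciusCMP2015, proof of Thm. 3.1 eqs. (3.4)–(3.5); Grimmett2006, Thm. (4.33)(c)] -/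
theorem IsDLRRandomCluster.sq_measureReal_percolatesAt_le_of_shift_invariant (hP : IsDLRRandomCluster d p q P)
    (hp : p ∈ Set.Ioc (0 : ℝ) 1) (hq : 0 < q) (hlat : ∀ᵐ ω ∂P, ω ⊆ (zdGraph d).edgeSet)
    (hshift : ∀ (v : Site d) {S : Set (BondConfig (Site d))}, MeasurableSet S →
      P (BondConfig.relabel (sym2Equiv (Site.shift v)) ⁻¹' S) = P S)
    {B : Finset (Site d)} (hB : B.Nonempty) :
    P.real (percolatesAt 0) ^ 2 ≤ (∑ x ∈ B, ∑ y ∈ B, P.real (openConn x y)) / (B.card : ℝ) ^ 2 := by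
  haveI := hP.isProbabilityMeasure
  exact sq_measureReal_percolatesAt_le P (measurePreserving_relabel_shift_of_forall P hshift)
    (hP.ae_numInfiniteClusters_le_one_of_shift_invariant hp hq hlat hshift) hB

/-- **No percolation without long-range order, every `q > 0`**: if a lattice-carried translation-invariant
`P ∈ R_{p,q}` (`0 < p ≤ 1`) has connectivities `P(x ↔ y) ≤ τ(x,y)` with `inf_B |B|⁻² ∑_{x,y∈B} τ(x,y) = 0`, then
`P(x ↔ ∞) = 0` for every `x`. [cite: AizenmanDuminilCopinSidoraviciusCMP2015, Thm. 3.1; Grimmett2006, Thm. (4.33)(c)] -/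
theorem IsDLRRandomCluster.measure_percolatesAt_eq_zero_of_shift_invariant_of_forall_exists
    (hP : IsDLRRandomCluster d p q P) (hp : p ∈ Set.Ioc (0 : ℝ) 1) (hq : 0 < q)
    (hlat : ∀ᵐ ω ∂P, ω ⊆ (zdGraph d).edgeSet)
    (hshift : ∀ (v : Site d) {S : Set (BondConfig (Site d))}, MeasurableSet S →
      P (BondConfig.relabel (sym2Equiv (Site.shift v)) ⁻¹' S) = P S)
    (τ : Site d → Site d → ℝ) (hτ : ∀ x y, P.real (openConn x y) ≤ τ x y)
    (hinf : ∀ ε : ℝ, 0 < ε → ∃ B : Finset (Site d), B.Nonempty ∧ (∑ x ∈ B, ∑ y ∈ B, τ x y) / (B.card : ℝ) ^ 2 < ε)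
    (x : Site d) : P (percolatesAt x) = 0 := by
  haveI := hP.isProbabilityMeasure
  exact measure_percolatesAt_eq_zero_of_forall_exists P (measurePreserving_relabel_shift_of_forall P hshift)
    (hP.ae_numInfiniteClusters_le_one_of_shift_invariant hp hq hlat hshift) τ hτ hinf x

/-- **ADS15 density bound for every translation-invariant local limit of (4.38)-measures, every `q > 0`**
(`0 < p ≤ 1`): `P(0 ↔ ∞)² ≤ |B|⁻² ∑_{x,y∈B} P(x ↔ y)`. [cite: AizenmanDuminilCopinSidoraviciusCMP2015, proof of Thm. 3.1; Grimmett2006, Thm. (4.33)(b)(c)] -/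
theorem sq_measureReal_percolatesAt_le_of_localLimit_of_shift_invariant [IsProbabilityMeasure P]
    {μ : ℕ → Measure (BondConfig (Site d))} [∀ n, IsFiniteMeasure (μ n)]
    (hp : p ∈ Set.Ioc (0 : ℝ) 1) (hq : 0 < q) (hlatP : ∀ᵐ ω ∂P, ω ⊆ (zdGraph d).edgeSet)
    (hconv : ∀ A : Set (BondConfig (Site d)), IsLocalEvent A → Tendsto (fun n => μ n A) atTop (𝓝 (P A)))
    (hE : ∀ ⦃x y : Site d⦄, (zdGraph d).Adj x y → ∀ᶠ n in atTop, ∀ ⦃H₀ : Set (BondConfig (Site d))⦄,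
      MeasurableSet H₀ →
      (μ n).real ({ω | s(x, y) ∈ ω} ∩ (fun η => η \ {s(x, y)}) ⁻¹' H₀) =
        p * (μ n).real ((fun η => η \ {s(x, y)}) ⁻¹' (H₀ ∩ openConn x y)) +
          p / (p + q * (1 - p)) * (μ n).real ((fun η => η \ {s(x, y)}) ⁻¹' (H₀ ∩ (openConn x y)ᶜ)))
    (hshift : ∀ (v : Site d) {S : Set (BondConfig (Site d))}, MeasurableSet S →
      P (BondConfig.relabel (sym2Equiv (Site.shift v)) ⁻¹' S) = P S)
    {B : Finset (Site d)} (hB : B.Nonempty) :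
    P.real (percolatesAt 0) ^ 2 ≤ (∑ x ∈ B, ∑ y ∈ B, P.real (openConn x y)) / (B.card : ℝ) ^ 2 :=
  sq_measureReal_percolatesAt_le P (measurePreserving_relabel_shift_of_forall P hshift)
    (ae_numInfiniteClusters_le_one_of_localLimit_of_shift_invariant hp hq hlatP hconv hE hshift) hB

/-- **Grimmett 2006, Thm. (4.33)(c) for the whole sandwich class, `q ≥ 1`-free form**: every TRANSLATION-INVARIANT
`FKGibbs d p q` measure (`0 < p ≤ 1`, `q > 0`) has almost surely at most one infinite open cluster — the tree's
`FKGibbs.ae_numInfiniteClusters_le_one_of_isTailTrivial` without the tail-triviality hypothesis (insertion tolerance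
`FKGibbs.insertion_tolerant` + Burton–Keane without ergodicity). [cite: Grimmett2006, Thm. (4.33)(c), Thm. (4.17)(b); BurtonKeane1989, Thm. 2] -/
theorem FKGibbs.ae_numInfiniteClusters_le_one_of_shift_invariant (hG : FKGibbs d p q P) (hp : p ∈ Set.Ioc (0 : ℝ) 1)
    (hq : 0 < q)
    (hshift : ∀ (v : Site d) {S : Set (BondConfig (Site d))}, MeasurableSet S →
      P (BondConfig.relabel (sym2Equiv (Site.shift v)) ⁻¹' S) = P S) :
    ∀ᵐ ω ∂P, numInfiniteClusters ω ≤ 1 := by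
  haveI := hG.isProbabilityMeasure
  exact Summit.CriticalPhenomena.PercolationContinuityZ3.Theorems.FK.ae_numInfiniteClusters_le_one_of_shift_invariant
    hG.ae_subset_edgeSet hshift fun N => (hG.insertion_tolerant hp hq N).imp fun c hc => ⟨hc.1, fun hS => hc.2 hS⟩

/-- **ADS15 density bound for every translation-invariant member of the sandwich class `FKGibbs`** (`0 < p ≤ 1`,
`q > 0`): `P(0 ↔ ∞)² ≤ |B|⁻² ∑_{x,y∈B} P(x ↔ y)`. [cite: AizenmanDuminilCopinSidoraviciusCMP2015, proof of Thm. 3.1; Grimmett2006, Thm. (4.33)(c)] -/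
theorem FKGibbs.sq_measureReal_percolatesAt_le_of_shift_invariant (hG : FKGibbs d p q P) (hp : p ∈ Set.Ioc (0 : ℝ) 1)
    (hq : 0 < q)
    (hshift : ∀ (v : Site d) {S : Set (BondConfig (Site d))}, MeasurableSet S →
      P (BondConfig.relabel (sym2Equiv (Site.shift v)) ⁻¹' S) = P S)
    {B : Finset (Site d)} (hB : B.Nonempty) :
    P.real (percolatesAt 0) ^ 2 ≤ (∑ x ∈ B, ∑ y ∈ B, P.real (openConn x y)) / (B.card : ℝ) ^ 2 := by
  haveI := hG.isProbabilityMeasure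
  exact sq_measureReal_percolatesAt_le P (measurePreserving_relabel_shift_of_forall P hshift)
    (hG.ae_numInfiniteClusters_le_one_of_shift_invariant hp hq hshift) hB

end Summit.CriticalPhenomena.PercolationContinuityZ3.Theorems.FK

end
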